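import Literature.MathematicalPhysics.QuantumFieldTheory.Balaban1983to89.Step
import Literature.MathematicalPhysics.QuantumFieldTheory.Balaban1983to89.T4CauchySum

/-!
# T4Crossover — the crossover sums of the uniqueness spine (cell `pub-balaban`, T4-DAG v1 node U4′, row T4-U4.L; bookkeeping)

HONEST FRAMING (cell `pub-balaban`, T4-DAG v1 PAGE 1).  The cell's T4 target is the existence AND uniqueness of the
continuum limit of Bałaban's unit-scale averaged loop expectations on a finite torus — a constructive-QFT statement
strictly beyond ultraviolet stability ([Balaban1989LargeFieldII] Thm 1 p. 355); it is NOT the Yang–Mills mass gap and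
NOT the Clay problem.  This module is the KERNEL part of node U4′ ("old-scale size domination") of that spine: two
elementary CROSSOVER LEMMAS about finite sums of minima of abstract real sequences, their summability over the number
of renormalization steps `K`, and the plug of that summability into node U6 (`T4CauchySum.cauchySeq_genFun`).  It
asserts NOTHING about Bałaban's renormalization-group objects: the one tree predicate it consumes,
`Step.Discrete031 b β′ K g gs` (the endpoint running of the effective couplings, (0.31) of [Balaban1987RG1] in the
tree's per-step normalisation `1/g² + b(K−k) ≤ 1/g_k² ≤ 1/g² + β′(K−k)`), enters as a HYPOTHESIS on an abstract
sequence `gs` (cell flag COND-BetaPertH), and only its LOWER half is used; every theorem is real analysis (`min`,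
`Real.rpow`, `Real.log`, geometric and p-series).  Value = kernel bookkeeping of an implication ⇐ named inputs; NOT
summit progress.

Printed context (verbatim, page-cited; the manuscripts under audit are quoted for CONTEXT only — no disputed step of
theirs is used anywhere below).  The two printed SIZE bounds whose shapes the crossover lemmas are built for are
[Balaban1988Convergent] Thm 2 p. 263: "Under the assumptions of Theorem 1 there exists a constant E_1 independent of
j, k, Ω, {Ω_j}, {Λ_j}, T (but dependent on the other constants occurring in the formulation of this theorem), such
that | Σ_{z∈Λ_j^0∩Ω} [E^{(j)}(Λ_j, U_k, z) − E^{(j)}(Λ_j, 1, z)] − β_j(g_{j−1}) A(φ, U_k) | ≤ E_1 Σ_{n=j}^k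
(L^{j−n})^β |Γ_n ∩ Ω| , (2.43) for β < 1, and sufficiently regular configurations U_k = U_k(V), e.g. for V
restricted by the characteristic functions in (2.18). The constant E_1 depends on β also, and grows to ∞ if β → 1."
and, same page: "Similarly, there exists an absolute constant R_1 such, that | Σ_{X∈D_j, X⊂Λ_j, X∩Ω≠∅} [R^{(j)}(X, U_k)
− R^{(j)}(X, 1)] | ≤ R_1 g_j^{κ_0} Σ_{n=j}^k |Γ_n ∩ Ω| , (2.44) for the regular configurations U_k. (In fact the
constant R_1 can be taken as equal to 1 for g_j sufficiently small.)"; the exponent κ_0 is that of (2.31) p. 260: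
"|R^{(j)}(X, (U, J))| ≤ g_j^{κ_0} exp(−κ d_j(X)) . (2.31) Here κ_0 can be chosen arbitrarily large, similarly as κ,
if the other parameters are fixed properly, as in [I]." … "The sum over j is controlled by g_j^{κ_0}."; and the
printed use of the coupling running to sum such powers over scales is (2.46) p. 263: "|R_k(U_k)| ≤ R_1 Σ_{n=1}^k
|Γ_n| Σ_{j=1}^n g_j^{κ_0} < R_1 Σ_{n=1}^k |Γ_n| g_n^{κ_0 − 6} < Σ_{n=1}^k |Γ_n| , (2.46) for κ_0 ≥ 7 and g
sufficiently small."  [Balaban1988Convergent, Thm 2 (2.43)–(2.44) p. 263; (2.31) p. 260; (2.46) p. 263]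
How the cell uses them (T4-DAG v1 §1 D6, §2 U4′ — the cell's DESIGN, not in print): the two infrared-matched runs
(A: K steps, B: K + 1 steps) are compared TERM BY TERM in the final-scale representation with the bound
min(SIZE_j, RATE_j) — for OLD scales j the printed sizes ((2.43): contraction `a = L^{−β}` per remaining scale;
(2.44): `R_1 g_j^{κ_0}`, small by asymptotic freedom through (0.31)), for RECENT scales the η-rate `θ^j` (nodes
U1–U3, U5b; hypotheses, not in print) times the multiplicity `Λ^{K−j}` (`Λ = L⁴`) of scale-j domains per unit
volume.  The present module is the arithmetic fact that both crossover sums are summable in K.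

What is proved (all [folklore]; `j` = scale of injection, `n = K − j` = number of remaining scales; every sum runs
over `Finset.antidiagonal K`, so no truncated subtraction occurs).
§1 Two-point interpolation `min(x, y) ≤ x^t y^{1−t}` (`x, y ≥ 0`, `t ∈ [0,1]`; with Mathlib's `Real.rpow_pow_comm`).
§2 Crossover lemma (i) (node U4′ (i)): for `a, θ, Λ ≥ 0`, any `t ∈ [0,1]`,
   `Σ_{j+n=K} min(a^n, θ^j Λ^n) ≤ (K+1) · max(θ^{1−t}, a^t Λ^{1−t})^K` (interpolate each term, then
   `T4CauchySum.pow_mul_pow_le_max_pow`); at the CROSSOVER EXPONENT `σ = log(1/a) / (log(Λ/θ) + log(1/a)) ∈ ]0,1]`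
   (`0 < a < 1`, `0 < θ ≤ Λ`) the two rates balance, `a^{1−σ} Λ^σ = θ^σ`, giving the node text's
   `Σ_{j≤K} min(a^{K−j}, θ^j Λ^{K−j}) ≤ (K+1) (θ^σ)^K` with `θ^σ < 1` for `θ < 1`; hence summability over K.
§3 Crossover lemma (ii) (node U4′ (ii)) by the OLD/RECENT cut at `n = σ(K+1)` remaining scales: old scales
   (`n ≥ σ(K+1)`) have `1/g_j² ≥ 1/g² + b n ≥ b σ (K+1)` (lower half of `Step.Discrete031`), so
   `R_1 g_j^{κ_0} ≤ R_1 (b σ (K+1))^{−κ_0/2}`; recent scales (`n ≤ σ(K+1)`) have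
   `C θ^j Λ^n = C θ^K (Λ/θ)^n ≤ C (Λ/θ)^σ (θ (Λ/θ)^σ)^K`; so
   `Σ_{j+n=K} min(R_1 g_j^{κ_0}, C θ^j Λ^n) ≤ (K+1) [R_1 (b σ (K+1))^{−κ_0/2} + C (Λ/θ)^σ (θ (Λ/θ)^σ)^K]`
   = O((K+1)^{1−κ_0/2}) + polynomial × geometric; a cut parameter with `θ (Λ/θ)^σ < 1` exists for `θ < 1`
   (`exists_recentRate_lt_one`), and the sum is summable over K for `κ_0 > 4` (shifted p-series
   `Real.summable_nat_rpow` + `T4CauchySum.summable_succ_pow_mul_geometric`).  The threshold `κ_0 > 4` is that of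
   the crude count (K+1) × (largest old term); (2.31) lets κ_0 be as large as needed.
§4 The plug: `crossoverDelta E a θ Λ R_1 C κ_0 gs w K = E·(sum (i)) + (sum (ii)) + w K` (w = the last-step /
   weight-class term of nodes U5c / NE7b, summable BY HYPOTHESIS) is summable (`summable_crossoverDelta`), and with
   node U5 in the shape `T4CauchySum.MatchingModConstants vol l₀ (crossoverDelta …) Z` the generating functions are
   Cauchy and converge uniformly on the closed l₀-ball (`cauchySum_of_crossover`, = `T4CauchySum.cauchySum` with
   the crossover majorant in place of the retired transported total `T4CauchySum.delta` of T4-DAG v0 node U4/NE6).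

Deliberately NOT here: any statement about E-terms, R-terms, effective actions or densities of Bałaban's procedure
(the instantiation SIZE_j ≤ E_1 a^n resp. R_1 g_j^{κ_0} is the cell's consumption of (2.43)/(2.44) BY NAME with their
dockets — tree `B14.Thm2Printed`, `B14Seam245.*`; the rates θ^j are the cell's NEW estimates NE2–NE5, NE7; none is
asserted); the existence of coupling sequences obeying (0.31) (tree `B12Beta`, `Beta.*`, under the cell's
COND-BetaPertH); the weight-class summability of `w` (node U5c).  Imports: `Step` (for the predicate
`Step.Discrete031` only) and `T4CauchySum`.
-/

namespace Literature.MathematicalPhysics.QuantumFieldTheory.Balaban1983to89.T4Crossover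

open Finset

/-! ## §1 Two-point interpolation -/

/-- Two-point interpolation: `min(x, y) ≤ x^t · y^{1−t}` for `x, y ≥ 0`, `t ∈ [0,1]`. [folklore] -/
theorem min_le_rpow_mul_rpow {x y t : ℝ} (hx : 0 ≤ x) (hy : 0 ≤ y) (ht0 : 0 ≤ t) (ht1 : t ≤ 1) :
    min x y ≤ x ^ t * y ^ (1 - t) := by
  have h1t : t + (1 - t) = 1 := by ring
  rcases le_total x y with hxy | hyx
  · rw [min_eq_left hxy]
    rcases hx.eq_or_lt with h0 | hx'
    · rw [← h0] at *
      exact le_of_eq_of_le rfl (mul_nonneg (Real.rpow_nonneg le_rfl _) (Real.rpow_nonneg hy _))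
    · calc x = x ^ t * x ^ (1 - t) := by rw [← Real.rpow_add hx', h1t, Real.rpow_one]
        _ ≤ x ^ t * y ^ (1 - t) :=
          mul_le_mul_of_nonneg_left (Real.rpow_le_rpow hx hxy (by linarith)) (Real.rpow_nonneg hx _)
  · rw [min_eq_right hyx]
    rcases hy.eq_or_lt with h0 | hy'
    · rw [← h0] at *
      exact le_of_eq_of_le rfl (mul_nonneg (Real.rpow_nonneg hx _) (Real.rpow_nonneg le_rfl _))
    · calc y = y ^ t * y ^ (1 - t) := by rw [← Real.rpow_add hy', h1t, Real.rpow_one]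
        _ ≤ x ^ t * y ^ (1 - t) :=
          mul_le_mul_of_nonneg_right (Real.rpow_le_rpow hy hyx ht0) (Real.rpow_nonneg hy _)

/-! ## §2 Crossover lemma (i): geometric injection rate against geometric growth of the remaining scales -/

/-- One term, any interpolation parameter `t ∈ [0,1]`: for `a, θ, Λ ≥ 0` and `j + n = K`,
`min(a^n, θ^j Λ^n) ≤ max(θ^{1−t}, a^t Λ^{1−t})^K`. [folklore] -/
theorem min_pow_le {a θ Λ t : ℝ} (ha : 0 ≤ a) (hθ : 0 ≤ θ) (hΛ : 0 ≤ Λ) (ht0 : 0 ≤ t) (ht1 : t ≤ 1)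
    {j n K : ℕ} (h : j + n = K) :
    min (a ^ n) (θ ^ j * Λ ^ n) ≤ (max (θ ^ (1 - t)) (a ^ t * Λ ^ (1 - t))) ^ K := by
  have h1 := min_le_rpow_mul_rpow (pow_nonneg ha n) (mul_nonneg (pow_nonneg hθ j) (pow_nonneg hΛ n)) ht0 ht1
  have h2 : (a ^ n) ^ t * (θ ^ j * Λ ^ n) ^ (1 - t) = (θ ^ (1 - t)) ^ j * (a ^ t * Λ ^ (1 - t)) ^ n := by
    rw [Real.mul_rpow (pow_nonneg hθ j) (pow_nonneg hΛ n), ← Real.rpow_pow_comm ha, ← Real.rpow_pow_comm hθ,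
      ← Real.rpow_pow_comm hΛ, mul_pow]
    ring
  rw [h2] at h1
  exact h1.trans (T4CauchySum.pow_mul_pow_le_max_pow (Real.rpow_nonneg hθ _)
    (mul_nonneg (Real.rpow_nonneg ha _) (Real.rpow_nonneg hΛ _)) h)

/-- **Crossover lemma (i), general interpolation parameter.**  For `a, θ, Λ ≥ 0`, `t ∈ [0,1]` and every `K`,
`Σ_{j+n=K} min(a^n, θ^j Λ^n) ≤ (K+1) · max(θ^{1−t}, a^t Λ^{1−t})^K`. [folklore] -/
theorem sum_min_pow_le {a θ Λ t : ℝ} (ha : 0 ≤ a) (hθ : 0 ≤ θ) (hΛ : 0 ≤ Λ) (ht0 : 0 ≤ t) (ht1 : t ≤ 1)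
    (K : ℕ) :
    ∑ p ∈ antidiagonal K, min (a ^ p.2) (θ ^ p.1 * Λ ^ p.2)
      ≤ ((K : ℝ) + 1) * (max (θ ^ (1 - t)) (a ^ t * Λ ^ (1 - t))) ^ K := by
  calc ∑ p ∈ antidiagonal K, min (a ^ p.2) (θ ^ p.1 * Λ ^ p.2)
      ≤ ∑ p ∈ antidiagonal K, (max (θ ^ (1 - t)) (a ^ t * Λ ^ (1 - t))) ^ K :=
        Finset.sum_le_sum fun p hp => min_pow_le ha hθ hΛ ht0 ht1 (mem_antidiagonal.mp hp)
    _ = ((K : ℝ) + 1) * (max (θ ^ (1 - t)) (a ^ t * Λ ^ (1 - t))) ^ K := by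
        rw [Finset.sum_const, Finset.Nat.card_antidiagonal, nsmul_eq_mul]
        push_cast
        ring

/-- The crossover exponent `σ = log(1/a) / (log(Λ/θ) + log(1/a))` lies in `]0, 1]` when `0 < a < 1` and
`0 < θ ≤ Λ`. [folklore] -/
theorem crossoverExp_pos_le_one {a θ Λ : ℝ} (ha0 : 0 < a) (ha1 : a < 1) (hθ : 0 < θ) (hθΛ : θ ≤ Λ) :
    0 < Real.log (1 / a) / (Real.log (Λ / θ) + Real.log (1 / a)) ∧
      Real.log (1 / a) / (Real.log (Λ / θ) + Real.log (1 / a)) ≤ 1 := by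
  have hA : 0 < Real.log (1 / a) := Real.log_pos (one_lt_one_div ha0 ha1)
  have hB : 0 ≤ Real.log (Λ / θ) := Real.log_nonneg ((one_le_div hθ).mpr hθΛ)
  refine ⟨div_pos hA (by linarith), ?_⟩
  rw [div_le_one (by linarith)]
  linarith

/-- At the crossover exponent the two interpolated rates BALANCE: `a^{1−σ} Λ^σ = θ^σ` for
`σ = log(1/a) / (log(Λ/θ) + log(1/a))`, `0 < a < 1`, `0 < θ ≤ Λ`. [folklore] -/
theorem crossover_balance {a θ Λ : ℝ} (ha0 : 0 < a) (ha1 : a < 1) (hθ : 0 < θ) (hθΛ : θ ≤ Λ) :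
    a ^ (1 - Real.log (1 / a) / (Real.log (Λ / θ) + Real.log (1 / a)))
        * Λ ^ (Real.log (1 / a) / (Real.log (Λ / θ) + Real.log (1 / a)))
      = θ ^ (Real.log (1 / a) / (Real.log (Λ / θ) + Real.log (1 / a))) := by
  have hΛ : 0 < Λ := hθ.trans_le hθΛ
  set σ := Real.log (1 / a) / (Real.log (Λ / θ) + Real.log (1 / a)) with hσ
  have hA : 0 < Real.log (1 / a) := Real.log_pos (one_lt_one_div ha0 ha1)
  have hB : 0 ≤ Real.log (Λ / θ) := Real.log_nonneg ((one_le_div hθ).mpr hθΛ)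
  have hAB : Real.log (Λ / θ) + Real.log (1 / a) ≠ 0 := by linarith
  have hlhs : 0 < a ^ (1 - σ) * Λ ^ σ := mul_pos (Real.rpow_pos_of_pos ha0 _) (Real.rpow_pos_of_pos hΛ _)
  have hrhs : 0 < θ ^ σ := Real.rpow_pos_of_pos hθ _
  refine Real.log_injOn_pos (Set.mem_Ioi.mpr hlhs) (Set.mem_Ioi.mpr hrhs) ?_
  rw [Real.log_mul (Real.rpow_pos_of_pos ha0 _).ne' (Real.rpow_pos_of_pos hΛ _).ne', Real.log_rpow ha0,
    Real.log_rpow hΛ, Real.log_rpow hθ]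
  have h1 : Real.log (1 / a) = -Real.log a := by rw [one_div, Real.log_inv]
  have h2 : Real.log (Λ / θ) = Real.log Λ - Real.log θ := Real.log_div hΛ.ne' hθ.ne'
  rw [hσ, h1, h2]
  rw [h1, h2] at hAB
  field_simp
  ring

/-- **Crossover lemma (i) (node U4′ (i), node D6).**  For `0 < a < 1`, `0 < θ ≤ Λ` and every `K`,
`Σ_{j+n=K} min(a^n, θ^j Λ^n) ≤ (K+1) · (θ^σ)^K`, `σ = log(1/a) / (log(Λ/θ) + log(1/a))` — the printed-shape
statement "Σ_{j≤K} min(a^{K−j}, θ^j Λ^{K−j}) ≤ (K+1) θ^{(1−s)K}, 1−s = log(1/a)/(log(Λ/θ)+log(1/a))" of the cell's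
node text, with `n = K − j` the number of remaining scales (no truncated subtraction: the sum runs over
`Finset.antidiagonal K`). [folklore] -/
theorem sum_min_pow_le_crossover {a θ Λ : ℝ} (ha0 : 0 < a) (ha1 : a < 1) (hθ : 0 < θ) (hθΛ : θ ≤ Λ) (K : ℕ) :
    ∑ p ∈ antidiagonal K, min (a ^ p.2) (θ ^ p.1 * Λ ^ p.2)
      ≤ ((K : ℝ) + 1) * (θ ^ (Real.log (1 / a) / (Real.log (Λ / θ) + Real.log (1 / a)))) ^ K := by
  set σ := Real.log (1 / a) / (Real.log (Λ / θ) + Real.log (1 / a)) with hσ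
  obtain ⟨hσ0, hσ1⟩ := crossoverExp_pos_le_one ha0 ha1 hθ hθΛ
  have hbal := crossover_balance ha0 ha1 hθ hθΛ
  rw [← hσ] at hσ0 hσ1 hbal
  have h := sum_min_pow_le ha0.le hθ.le (hθ.le.trans hθΛ) (t := 1 - σ) (by linarith) (by linarith) K
  have h1 : (1 : ℝ) - (1 - σ) = σ := by ring
  rw [h1, hbal, max_self] at h
  exact h

/-- The crossover rate is a CONTRACTION: `θ^σ < 1` for `0 < θ < 1` and the (positive) crossover exponent.
[folklore] -/
theorem crossoverRate_lt_one {a θ Λ : ℝ} (ha0 : 0 < a) (ha1 : a < 1) (hθ : 0 < θ) (hθ1 : θ < 1) (hθΛ : θ ≤ Λ) :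
    θ ^ (Real.log (1 / a) / (Real.log (Λ / θ) + Real.log (1 / a))) < 1 :=
  Real.rpow_lt_one hθ.le hθ1 (crossoverExp_pos_le_one ha0 ha1 hθ hθΛ).1

/-- **Summability of crossover sum (i) over the number of steps `K`** (node U4′: "summable over K"): for
`0 < a < 1`, `0 < θ < 1`, `θ ≤ Λ`, `K ↦ Σ_{j+n=K} min(a^n, θ^j Λ^n)` is summable (comparison with `(K+1) q^K`,
`q = θ^σ < 1`). [folklore] -/
theorem summable_sum_min_pow {a θ Λ : ℝ} (ha0 : 0 < a) (ha1 : a < 1) (hθ : 0 < θ) (hθ1 : θ < 1) (hθΛ : θ ≤ Λ) :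
    Summable (fun K : ℕ => ∑ p ∈ antidiagonal K, min (a ^ p.2) (θ ^ p.1 * Λ ^ p.2)) := by
  set q := θ ^ (Real.log (1 / a) / (Real.log (Λ / θ) + Real.log (1 / a))) with hq
  have hq0 : 0 ≤ q := Real.rpow_nonneg hθ.le _
  have hq1 : q < 1 := crossoverRate_lt_one ha0 ha1 hθ hθ1 hθΛ
  have hs := T4CauchySum.summable_succ_pow_mul_geometric hq0 hq1 1
  simp only [pow_one] at hs
  refine Summable.of_nonneg_of_le (fun K => Finset.sum_nonneg fun p _ => ?_) (fun K => ?_) hs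
  · exact le_min (pow_nonneg ha0.le _) (mul_nonneg (pow_nonneg hθ.le _) (pow_nonneg (hθ.le.trans hθΛ) _))
  · exact sum_min_pow_le_crossover ha0 ha1 hθ hθΛ K

/-! ## §3 Crossover lemma (ii): polynomially decaying couplings against geometric growth — the old/recent cut -/

/-- OLD SCALES.  If the coupling at the scale of injection obeys `D ≤ 1/g_j²` with `D > 0` (many remaining scales:
`D = b·σ·(K+1) ≤ b·n ≤ 1/g² + b·n`, the LOWER half of the endpoint running `Step.Discrete031`), then
`min(R₁ g_j^{κ₀}, y) ≤ R₁ · (D⁻¹)^{κ₀/2}`. [folklore] -/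
theorem min_le_of_inv_sq_le {R₁ D g : ℝ} {κ₀ : ℕ} (hR₁ : 0 ≤ R₁) (hg : 0 ≤ g) (hD : 0 < D) (h : D ≤ 1 / g ^ 2)
    (y : ℝ) : min (R₁ * g ^ κ₀) y ≤ R₁ * D⁻¹ ^ ((κ₀ : ℝ) / 2) := by
  refine (min_le_left _ _).trans (mul_le_mul_of_nonneg_left ?_ hR₁)
  have hg2 : g ^ 2 ≤ D⁻¹ := by
    have hgpos : 0 < g ^ 2 := by
      rcases (sq_nonneg g).eq_or_lt with h0 | h0
      · rw [← h0] at h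
        simp at h
        linarith
      · exact h0
    calc g ^ 2 = 1 / (1 / g ^ 2) := by rw [one_div_one_div]
      _ ≤ 1 / D := one_div_le_one_div_of_le hD h
      _ = D⁻¹ := one_div D
  calc g ^ κ₀ = (g ^ 2) ^ ((κ₀ : ℝ) / 2) := by
        rw [← Real.rpow_natCast g κ₀, ← Real.rpow_natCast g 2, ← Real.rpow_mul hg]
        congr 1
        push_cast
        ring
    _ ≤ D⁻¹ ^ ((κ₀ : ℝ) / 2) := Real.rpow_le_rpow (sq_nonneg g) hg2 (by positivity)

/-- RECENT SCALES.  For `0 < θ ≤ Λ`, `C ≥ 0`, `j + n = K` and few remaining scales `n ≤ σ·(K+1)`: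
`min(x, C θ^j Λ^n) ≤ C · (Λ/θ)^σ · (θ·(Λ/θ)^σ)^K`. [folklore] -/
theorem min_le_of_remaining_le {C θ Λ σ : ℝ} (hC : 0 ≤ C) (hθ : 0 < θ) (hθΛ : θ ≤ Λ) {j n K : ℕ}
    (h : j + n = K) (hn : (n : ℝ) ≤ σ * ((K : ℝ) + 1)) (x : ℝ) :
    min x (C * θ ^ j * Λ ^ n) ≤ C * (Λ / θ) ^ σ * (θ * (Λ / θ) ^ σ) ^ K := by
  refine (min_le_right _ _).trans ?_
  have hr1 : 1 ≤ Λ / θ := (one_le_div hθ).mpr hθΛ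
  have hr0 : 0 < Λ / θ := one_pos.trans_le hr1
  have hΛ : Λ = θ * (Λ / θ) := by field_simp
  have h1 : θ ^ j * Λ ^ n = θ ^ K * (Λ / θ) ^ n := by
    rw [← h, pow_add]
    conv_lhs => rw [hΛ, mul_pow]
    ring
  have h2 : (Λ / θ) ^ n ≤ (Λ / θ) ^ σ * ((Λ / θ) ^ σ) ^ K := by
    calc (Λ / θ) ^ n = (Λ / θ) ^ (n : ℝ) := (Real.rpow_natCast _ n).symm
      _ ≤ (Λ / θ) ^ (σ * ((K : ℝ) + 1)) := Real.rpow_le_rpow_of_exponent_le hr1 hn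
      _ = (Λ / θ) ^ σ * ((Λ / θ) ^ σ) ^ K := by
          rw [mul_add, mul_one, Real.rpow_add hr0, Real.rpow_mul_natCast hr0.le, mul_comm]
  calc C * θ ^ j * Λ ^ n = C * θ ^ K * (Λ / θ) ^ n := by rw [mul_assoc, h1, ← mul_assoc]
    _ ≤ C * θ ^ K * ((Λ / θ) ^ σ * ((Λ / θ) ^ σ) ^ K) :=
        mul_le_mul_of_nonneg_left h2 (mul_nonneg hC (pow_nonneg hθ.le K))
    _ = C * (Λ / θ) ^ σ * (θ * (Λ / θ) ^ σ) ^ K := by rw [mul_pow]; ring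

/-- **Crossover lemma (ii), one term (node U4′ (ii)).**  Under the LOWER half of the endpoint running (0.31) in the
tree's per-step normalisation `Step.Discrete031 b β′ K g gs` (`1/g² + b(K−k) ≤ 1/g_k²`, `b > 0`), nonnegative
couplings, `R₁, C ≥ 0`, `0 < θ ≤ Λ`, a cut parameter `σ > 0`, and `j + n = K`:
`min(R₁ g_j^{κ₀}, C θ^j Λ^n) ≤ R₁ (b σ (K+1))^{−κ₀/2} + C (Λ/θ)^σ (θ (Λ/θ)^σ)^K` — the first summand from the OLD
scales (`n ≥ σ(K+1)`), the second from the RECENT ones (`n ≤ σ(K+1)`). [folklore] -/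
theorem min_coupling_le {b β' g R₁ C θ Λ σ : ℝ} {K : ℕ} {gs : ℕ → ℝ} {κ₀ : ℕ} (hb : 0 < b)
    (h031 : Step.Discrete031 b β' K g gs) (hpos : ∀ k, k ≤ K → 0 ≤ gs k) (hR₁ : 0 ≤ R₁) (hC : 0 ≤ C)
    (hθ : 0 < θ) (hθΛ : θ ≤ Λ) (hσ : 0 < σ) {j n : ℕ} (h : j + n = K) :
    min (R₁ * gs j ^ κ₀) (C * θ ^ j * Λ ^ n)
      ≤ R₁ * (b * σ * ((K : ℝ) + 1))⁻¹ ^ ((κ₀ : ℝ) / 2) + C * (Λ / θ) ^ σ * (θ * (Λ / θ) ^ σ) ^ K := by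
  have hr0 : 0 < Λ / θ := div_pos (hθ.trans_le hθΛ) hθ
  have hold0 : 0 ≤ R₁ * (b * σ * ((K : ℝ) + 1))⁻¹ ^ ((κ₀ : ℝ) / 2) :=
    mul_nonneg hR₁ (Real.rpow_nonneg (inv_nonneg.mpr (by positivity)) _)
  have hrec0 : 0 ≤ C * (Λ / θ) ^ σ * (θ * (Λ / θ) ^ σ) ^ K :=
    mul_nonneg (mul_nonneg hC (Real.rpow_nonneg hr0.le _))
      (pow_nonneg (mul_nonneg hθ.le (Real.rpow_nonneg hr0.le _)) K)
  have hj : j ≤ K := by omega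
  by_cases hn : σ * ((K : ℝ) + 1) ≤ (n : ℝ)
  · -- OLD scales: many remaining scales, the coupling at the scale of injection is small
    have hD : 0 < b * σ * ((K : ℝ) + 1) := by positivity
    have hKj : (K : ℝ) - j = n := by
      have : (K : ℝ) = j + n := by rw [← h]; push_cast; ring
      linarith
    have hle : b * σ * ((K : ℝ) + 1) ≤ 1 / gs j ^ 2 := by
      have h1 := (h031 j hj).1
      rw [hKj] at h1
      have h2 : 0 ≤ 1 / g ^ 2 := div_nonneg zero_le_one (sq_nonneg g)
      nlinarith
    exact (min_le_of_inv_sq_le hR₁ (hpos j hj) hD hle _).trans (le_add_of_nonneg_right hrec0)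
  · -- RECENT scales: few remaining scales, the geometric growth is affordable
    exact (min_le_of_remaining_le hC hθ hθΛ h (not_le.mp hn).le _).trans (le_add_of_nonneg_left hold0)

/-- **Crossover lemma (ii), the sum (node U4′ (ii), node D6).**  Same hypotheses; for every `K`,
`Σ_{j+n=K} min(R₁ g_j^{κ₀}, C θ^j Λ^n) ≤ (K+1) · [R₁ (b σ (K+1))^{−κ₀/2} + C (Λ/θ)^σ (θ (Λ/θ)^σ)^K]` — i.e.
`O((K+1)^{1−κ₀/2}) + (polynomial × geometric)`, the node text's "≤ C′(K+1)^{1−κ₀/2} + (geometric)". [folklore] -/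
theorem sum_min_coupling_le {b β' g R₁ C θ Λ σ : ℝ} {K : ℕ} {gs : ℕ → ℝ} {κ₀ : ℕ} (hb : 0 < b)
    (h031 : Step.Discrete031 b β' K g gs) (hpos : ∀ k, k ≤ K → 0 ≤ gs k) (hR₁ : 0 ≤ R₁) (hC : 0 ≤ C)
    (hθ : 0 < θ) (hθΛ : θ ≤ Λ) (hσ : 0 < σ) :
    ∑ p ∈ antidiagonal K, min (R₁ * gs p.1 ^ κ₀) (C * θ ^ p.1 * Λ ^ p.2)
      ≤ ((K : ℝ) + 1) *
        (R₁ * (b * σ * ((K : ℝ) + 1))⁻¹ ^ ((κ₀ : ℝ) / 2) + C * (Λ / θ) ^ σ * (θ * (Λ / θ) ^ σ) ^ K) := by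
  calc ∑ p ∈ antidiagonal K, min (R₁ * gs p.1 ^ κ₀) (C * θ ^ p.1 * Λ ^ p.2)
      ≤ ∑ p ∈ antidiagonal K,
          (R₁ * (b * σ * ((K : ℝ) + 1))⁻¹ ^ ((κ₀ : ℝ) / 2) + C * (Λ / θ) ^ σ * (θ * (Λ / θ) ^ σ) ^ K) :=
        Finset.sum_le_sum fun p hp => min_coupling_le hb h031 hpos hR₁ hC hθ hθΛ hσ (mem_antidiagonal.mp hp)
    _ = _ := by
        rw [Finset.sum_const, Finset.Nat.card_antidiagonal, nsmul_eq_mul]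
        push_cast
        ring

/-- The recent-scale rate in product form: `θ · (Λ/θ)^σ = θ^{1−σ} · Λ^σ` (`0 < θ`, `0 ≤ Λ`). [folklore] -/
theorem recentRate_eq {θ Λ : ℝ} (hθ : 0 < θ) (hΛ : 0 ≤ Λ) (σ : ℝ) :
    θ * (Λ / θ) ^ σ = θ ^ (1 - σ) * Λ ^ σ := by
  have h1 : 0 < θ ^ σ := Real.rpow_pos_of_pos hθ σ
  rw [Real.div_rpow hΛ hθ.le, Real.rpow_sub hθ, Real.rpow_one]
  field_simp

/-- A cut parameter making the recent-scale rate a CONTRACTION exists: for `0 < θ < 1`, `θ ≤ Λ` there is `σ > 0`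
with `θ · (Λ/θ)^σ < 1` (explicitly `σ = 1` if `Λ = θ`, else `σ = log(1/θ) / (2 log(Λ/θ))`, for which the rate is
`θ^{1/2}`). [folklore] -/
theorem exists_recentRate_lt_one {θ Λ : ℝ} (hθ : 0 < θ) (hθ1 : θ < 1) (hθΛ : θ ≤ Λ) :
    ∃ σ : ℝ, 0 < σ ∧ θ * (Λ / θ) ^ σ < 1 := by
  rcases hθΛ.eq_or_lt with h | hlt
  · refine ⟨1, one_pos, ?_⟩
    rw [← h, div_self hθ.ne', Real.one_rpow, mul_one]
    exact hθ1
  · have hr : 1 < Λ / θ := (one_lt_div hθ).mpr hlt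
    have hr0 : 0 < Λ / θ := one_pos.trans hr
    have hlr : 0 < Real.log (Λ / θ) := Real.log_pos hr
    have hl1 : 0 < Real.log (1 / θ) := Real.log_pos (one_lt_one_div hθ hθ1)
    refine ⟨Real.log (1 / θ) / (2 * Real.log (Λ / θ)), div_pos hl1 (by positivity), ?_⟩
    have hq0 : 0 < θ * (Λ / θ) ^ (Real.log (1 / θ) / (2 * Real.log (Λ / θ))) :=
      mul_pos hθ (Real.rpow_pos_of_pos hr0 _)
    have hlog : Real.log (θ * (Λ / θ) ^ (Real.log (1 / θ) / (2 * Real.log (Λ / θ)))) = Real.log θ / 2 := by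
      rw [Real.log_mul hθ.ne' (Real.rpow_pos_of_pos hr0 _).ne', Real.log_rpow hr0, one_div, Real.log_inv]
      field_simp
      ring
    rw [← Real.exp_log hq0, hlog, Real.exp_lt_one_iff]
    exact div_neg_of_neg_of_pos (Real.log_neg hθ hθ1) two_pos

/-- Polynomial summability of the old-scale part: `Σ_K (K+1) · ((c (K+1))⁻¹)^p < ∞` for `c > 0`, `p > 2`
(a shifted p-series, `Real.summable_nat_rpow`). [folklore] -/
theorem summable_succ_mul_inv_rpow {c p : ℝ} (hc : 0 < c) (hp : 2 < p) :
    Summable (fun K : ℕ => ((K : ℝ) + 1) * (c * ((K : ℝ) + 1))⁻¹ ^ p) := by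
  have h1 : Summable (fun K : ℕ => ((K : ℝ) + 1) ^ (1 - p)) := by
    have := (summable_nat_add_iff 1).mpr (Real.summable_nat_rpow.mpr (by linarith : 1 - p < -1))
    simpa using this
  refine (h1.mul_left (c⁻¹ ^ p)).congr fun K => ?_
  have hK : 0 < (K : ℝ) + 1 := by positivity
  rw [mul_inv, Real.mul_rpow (inv_nonneg.mpr hc.le) (inv_nonneg.mpr hK.le), Real.inv_rpow hK.le,
    Real.rpow_sub hK, Real.rpow_one]
  field_simp

/-- **Summability of crossover sum (ii) over the number of steps `K`** (node U4′: "summable over K ⇒ the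
`Summable δ` input of `T4CauchySum.cauchySeq_genFun`").  For runs indexed by `K` whose coupling sequences `gs K`
obey the LOWER half of `Step.Discrete031 b β′ K (g K) (gs K)` (`b > 0`) and are nonnegative, `R₁, C ≥ 0`,
`0 < θ ≤ Λ`, a cut parameter `σ > 0` whose recent-scale rate `θ (Λ/θ)^σ` is `< 1` (`exists_recentRate_lt_one`), and
`κ₀ > 4`: `K ↦ Σ_{j+n=K} min(R₁ (gs K j)^{κ₀}, C θ^j Λ^n)` is summable.  The threshold `κ₀ > 4` is that of the
crude count `(K+1) · (b σ (K+1))^{−κ₀/2}`. [folklore] -/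
theorem summable_sum_min_coupling {b β' R₁ C θ Λ σ : ℝ} {g : ℕ → ℝ} {gs : ℕ → ℕ → ℝ} {κ₀ : ℕ} (hb : 0 < b)
    (h031 : ∀ K, Step.Discrete031 b β' K (g K) (gs K)) (hpos : ∀ K k, k ≤ K → 0 ≤ gs K k) (hR₁ : 0 ≤ R₁)
    (hC : 0 ≤ C) (hθ : 0 < θ) (hθΛ : θ ≤ Λ) (hσ : 0 < σ) (hq : θ * (Λ / θ) ^ σ < 1) (hκ : 4 < κ₀) :
    Summable (fun K : ℕ => ∑ p ∈ antidiagonal K, min (R₁ * gs K p.1 ^ κ₀) (C * θ ^ p.1 * Λ ^ p.2)) := by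
  have hr0 : 0 < Λ / θ := div_pos (hθ.trans_le hθΛ) hθ
  have hq0 : 0 ≤ θ * (Λ / θ) ^ σ := mul_nonneg hθ.le (Real.rpow_nonneg hr0.le _)
  have hκ' : (2 : ℝ) < (κ₀ : ℝ) / 2 := by
    have : (4 : ℝ) < κ₀ := by exact_mod_cast hκ
    linarith
  have hA := (summable_succ_mul_inv_rpow (mul_pos hb hσ) hκ').mul_left R₁
  have hB := (T4CauchySum.summable_succ_pow_mul_geometric hq0 hq 1).mul_left (C * (Λ / θ) ^ σ)
  have hbound : Summable (fun K : ℕ => ((K : ℝ) + 1) *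
      (R₁ * (b * σ * ((K : ℝ) + 1))⁻¹ ^ ((κ₀ : ℝ) / 2) + C * (Λ / θ) ^ σ * (θ * (Λ / θ) ^ σ) ^ K)) := by
    refine (hA.add hB).congr fun K => ?_
    simp only [pow_one]
    ring
  refine Summable.of_nonneg_of_le (fun K => Finset.sum_nonneg fun p hp => ?_) (fun K => ?_) hbound
  · have hj : p.1 ≤ K := by have := mem_antidiagonal.mp hp; omega
    exact le_min (mul_nonneg hR₁ (pow_nonneg (hpos K p.1 hj) _))
      (mul_nonneg (mul_nonneg hC (pow_nonneg hθ.le _)) (pow_nonneg (hθ.le.trans hθΛ) _))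
  · exact sum_min_coupling_le hb (h031 K) (hpos K) hR₁ hC hθ hθΛ hσ

/-! ## §4 The plug into node U6: `Summable δ` for `T4CauchySum.cauchySeq_genFun` -/

/-- The CROSSOVER MAJORANT of the discrepancy between the two runs at `K` steps (node U4′ ⇒ U6 shape; a FUNCTION
of abstract sizes — nothing of Bałaban's is asserted): E-terms, contracted by `a` per remaining scale (`a = L^{−β}`,
the printed (2.43)) and matched against the recent-scale η-rate `θ^j` times the multiplicity `Λ^n` of scale-`j`
domains per unit volume (`Λ = L⁴`); R-terms, NOT contracted but carrying the coupling power `R₁ g_j^{κ₀}` (the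
printed (2.44)); and a last-step / weight-class term `w K` (nodes U5c, NE7b), summable by hypothesis:
`crossoverDelta E a θ Λ R₁ C κ₀ gs w K = E · Σ_{j+n=K} min(a^n, θ^j Λ^n) + Σ_{j+n=K} min(R₁ (gs K j)^{κ₀}, C θ^j Λ^n)
+ w K`. [folklore] -/
noncomputable def crossoverDelta (E a θ Λ R₁ C : ℝ) (κ₀ : ℕ) (gs : ℕ → ℕ → ℝ) (w : ℕ → ℝ) (K : ℕ) : ℝ :=
  E * (∑ p ∈ antidiagonal K, min (a ^ p.2) (θ ^ p.1 * Λ ^ p.2))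
    + (∑ p ∈ antidiagonal K, min (R₁ * gs K p.1 ^ κ₀) (C * θ ^ p.1 * Λ ^ p.2)) + w K

/-- **`Summable δ` (node U4′: "both summable over K ⇒ the `Summable δ` input of `T4CauchySum.cauchySeq_genFun`").**
For `0 < a < 1`, `0 < θ < 1`, `θ ≤ Λ`, the LOWER half of `Step.Discrete031 b β′ K (g K) (gs K)` for every `K`
(`b > 0`, nonnegative couplings), `R₁, C ≥ 0`, `κ₀ > 4` and a summable `w`, the crossover majorant is summable
(the cut parameter of §3 is chosen by `exists_recentRate_lt_one`). [folklore] -/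
theorem summable_crossoverDelta {E a θ Λ b β' R₁ C : ℝ} {κ₀ : ℕ} {g : ℕ → ℝ} {gs : ℕ → ℕ → ℝ} {w : ℕ → ℝ}
    (ha0 : 0 < a) (ha1 : a < 1) (hθ : 0 < θ) (hθ1 : θ < 1) (hθΛ : θ ≤ Λ) (hb : 0 < b)
    (h031 : ∀ K, Step.Discrete031 b β' K (g K) (gs K)) (hpos : ∀ K k, k ≤ K → 0 ≤ gs K k) (hR₁ : 0 ≤ R₁)
    (hC : 0 ≤ C) (hκ : 4 < κ₀) (hw : Summable w) :
    Summable (crossoverDelta E a θ Λ R₁ C κ₀ gs w) := by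
  obtain ⟨σ, hσ, hq⟩ := exists_recentRate_lt_one hθ hθ1 hθΛ
  exact (((summable_sum_min_pow ha0 ha1 hθ hθ1 hθΛ).mul_left E).add
    (summable_sum_min_coupling hb h031 hpos hR₁ hC hθ hθΛ hσ hq hκ)).add hw

/-- **Node U6 from U4′ + U5 (CONDITIONAL kernel theorem; cf. `T4CauchySum.cauchySum`).**  If node U5 delivers the
matching MODULO CONSTANTS of the two runs' dressed partition functions with remainder `vol · crossoverDelta … K` on
`|t| ≤ l₀` (`T4CauchySum.MatchingModConstants`; a hypothesis — the cell's NEW estimate NE7, not in print), then under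
the hypotheses of `summable_crossoverDelta` the majorant is summable, every generating-function sequence
`K ↦ genFun Z K t`, `|t| ≤ l₀`, is Cauchy, and the convergence to `genFunLim Z` is uniform on the closed `l₀`-ball —
the input node U0 consumes. [folklore] -/
theorem cauchySum_of_crossover {E a θ Λ b β' R₁ C vol l₀ : ℝ} {κ₀ : ℕ} {g : ℕ → ℝ} {gs : ℕ → ℕ → ℝ} {w : ℕ → ℝ}
    {Z : ℕ → ℝ → ℝ} (ha0 : 0 < a) (ha1 : a < 1) (hθ : 0 < θ) (hθ1 : θ < 1) (hθΛ : θ ≤ Λ) (hb : 0 < b)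
    (h031 : ∀ K, Step.Discrete031 b β' K (g K) (gs K)) (hpos : ∀ K k, k ≤ K → 0 ≤ gs K k) (hR₁ : 0 ≤ R₁)
    (hC : 0 ≤ C) (hκ : 4 < κ₀) (hw : Summable w) (hl₀ : 0 ≤ l₀)
    (hU5 : T4CauchySum.MatchingModConstants vol l₀ (crossoverDelta E a θ Λ R₁ C κ₀ gs w) Z) :
    Summable (crossoverDelta E a θ Λ R₁ C κ₀ gs w) ∧
    (∀ t : ℝ, |t| ≤ l₀ → CauchySeq fun K => T4CauchySum.genFun Z K t) ∧
    TendstoUniformlyOn (fun K t => T4CauchySum.genFun Z K t) (T4CauchySum.genFunLim Z) Filter.atTop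
      {t | |t| ≤ l₀} := by
  have hδ := summable_crossoverDelta (E := E) (Λ := Λ) (R₁ := R₁) (C := C) (w := w)
    ha0 ha1 hθ hθ1 hθΛ hb h031 hpos hR₁ hC hκ hw
  exact ⟨hδ, fun t ht => T4CauchySum.cauchySeq_genFun hU5 hl₀ hδ ht,
    T4CauchySum.tendstoUniformlyOn_genFun hU5 hl₀ hδ⟩

end Literature.MathematicalPhysics.QuantumFieldTheory.Balaban1983to89.T4Crossover
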